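import Mathlib
import HarnessLib
import Literature.AlgebraicGeometry.HodgeTheory.FlatFamilyCycleClass
import Summits.HodgeConjecture.HodgeConjecture.Theorems.EightfoldBlochSeedsBlochSpreadEightFourSupportAlongChart
import Summits.HodgeConjecture.HodgeConjecture.Theorems.EightfoldBlochSeedsBlochSpreadEightFourFultonCorners

/-!
# Fulton's specialisation of the cycle class of a flat family: the SUPPORT step, the reduction of the
# stub `stub_fultonSpecialises` to a supported relative class, and the gap inventory

HONEST FRAMING: helper file for the crux `BlochSpreadEightFour` (stmt-HodgeConjecture-18884), line
`Lines/bloch_lifts_fulton.lean`, stub `stub_fultonSpecialises : fulton1998_flatFamily_cycleClass_specialises`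
(the tree's NAMED FACT — Fulton 1998 Prop. 10.1 (a), Cor. 10.1, Lemma 19.1.1, Cor. 19.2 (b) — rendered on the
real carriers `complexBetti`, `classesSupportedOn`, `algebraicClasses`). The stub is NOT closed here; nothing
in this file proves `BlochSpreadEightFour`, rung H2, HC_AV or HC. Companion of
`EightfoldBlochSeedsBlochSpreadEightFourFultonCorners.lean` (corners `p = 0`, `n < p`, `…_of_interior`).

## What is proved (sorry-free, no new notion, no named fact consumed)

* `map_fiberι_mem_algebraicClasses_of_mem_classesSupportedOn` — **the support step** (conclusion (1) of
  the fact, "every fibre restriction `Γ|_{𝒳_t}` is algebraic", from supports alone): if a global class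
  `Γ ∈ H²ᵖ(𝒳(ℂ); ℂ)` is supported on a Zariski-closed `T ⊆ 𝒳` (`classesSupportedOn`) and every point of the
  slice `𝒳_t ∩ T` has codimension `≥ p` IN THE FIBRE `𝒳_t`, then `Γ|_{𝒳_t} ∈ algebraicClasses (𝒳_t) p`
  (`= Nᵖ H²ᵖ(𝒳_t(ℂ); ℂ)`): pull-back respects supports (the landed
  `mem_classesSupportedOn_map_preimage`, Grothendieck 1969 §1) and a class supported on a closed set of
  codimension `≥ p` is algebraic by the DEFINITION of `algebraicClasses` (`classesSupportedOn_le_supportedClasses`).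
  This is Fulton §19.1 eq. (1) ("the cycle class is supported on the support of the cycle") read on the
  tree's carriers; no cycle class map is needed for it.
* `fulton1998_flatFamily_cycleClass_specialises_of_supportedRelativeClass` — **reduction**: the named fact
  follows (via `…_of_interior`) from the statement `(RC)` "in the interior range `0 < p ≤ n` there are a
  Zariski-closed `T ⊆ 𝒳` all of whose fibre slices have codimension `≥ p` in their fibre, a global class
  `Γ` SUPPORTED ON `T`, and `w, c₀` as in the fact" — i.e. conclusion (1) of the fact is discharged by the
  support step once `Γ` is produced as a class supported on (the codimension-`p` part of) the flat family.

## Gap inventory for `stub_fultonSpecialises` (why `(RC)` cannot be written today; sizes)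

Notation: `g : 𝒳 ⟶ V` smooth projective family of relative dimension `n` over a smooth `V`, `ι : 𝒲 ↪ 𝒳`
closed and flat over `V`, `v₀ ∈ V(ℂ)`, `𝒲_{v₀} = W₀ ∪ C` as in the fact, `1 ≤ p ≤ n`.

* (F1) RELATIVE CYCLE CLASS ON THE (NON-PROPER) TOTAL SPACE [L–XL]: a class
  `Γ = cl(𝒲⁽ᵖ⁾) ∈ H²ᵖ(𝒳(ℂ); ℂ)` of the codimension-`p` part `𝒲⁽ᵖ⁾` of `𝒲` (union `T` of the irreducible
  components of `𝒲` of codimension `p` in `𝒳`), SUPPORTED ON `T`: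
  `∃ Γ : complexBetti 𝒳 (2 * p), Γ ∈ classesSupportedOn 𝒳 T (2 * p) ∧ …(F2)`. Classically: the
  Borel–Moore fundamental class `[T] ∈ H^{BM}_{2(N-p)}(T(ℂ))` and the duality
  `H^{BM}_{2(N-p)}(T(ℂ)) ≅ H²ᵖ_T(𝒳(ℂ))` on the complex MANIFOLD `𝒳(ℂ)` (`N = dim 𝒳`), Fulton §19.1 eq. (1).
  Tree: fundamental classes and Gysin maps only for COMPACT `X(ℂ)` (`complexGysin`,
  `ComplexOrientationFamily`, both for `IsSmoothProjective`); `𝒳` here is only quasi-projective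
  (`V` is not proper), so neither Borel–Moore homology nor `H²ᵖ_T` with its purity below the codimension
  is available. [cite: Fulton1998, §19.1 eq. (1)]
* (F2) BASE CHANGE TO A FIBRE [L]: `Γ|_{𝒳_t} = cl[𝒲⁽ᵖ⁾_t] = Σ_D m_D cl(D)` (Fulton Prop. 10.1 (a): the
  specialisation of `[𝒲]` is the fundamental cycle of the scheme-theoretic fibre, all `m_D ≥ 1`;
  Cor. 19.2 (b) / Ex. 19.2.1: `cl` commutes with the refined Gysin map of the regular embedding
  `𝒳_t ↪ 𝒳`). On the tree's carriers only its consequence at `v₀` is consumed: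
  `complexBetti.map (fiberι g v₀) (2 * p) Γ - c₀ • w ∈ classesSupportedOn (fiberOver g v₀) C (2 * p)` with
  `c₀ = m_{W₀} ≠ 0` and `w = cl(W₀)`. Needs (F1) on `𝒳` AND on the compact fibre, and their compatibility.
  [cite: Fulton1998, §10.1 Prop. 10.1 (a); §19.2 Cor. 19.2 (b), Example 19.2.1]
* (F3) SUPPORT ⇒ ALGEBRAIC [S, PROVED here]: `map_fiberι_mem_algebraicClasses_of_mem_classesSupportedOn`.
* (F4) FIBRE CODIMENSION OF A FLAT FAMILY [M]: every point of `𝒳_t ∩ T` has codimension `≥ p` in `𝒳_t`,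
  for every `t ∈ V(ℂ)`: `∀ t (z : (fiberOver g t).left), (fiberι g t).left.base z ∈ T → (p : ℕ∞) ≤
  Order.coheight z`. A catenarity-free route on the tree's carriers (`V` irreducible, smooth of relative
  dimension `r`; `N = n + r = dim 𝒳`; `e = n - p`): let `ζ` be the generic point of an irreducible
  component of `𝒲_t` containing `closure {z}`; (i) `dim 𝒪_{𝒲,ζ} = dim 𝒪_{V,t} + dim 𝒪_{𝒲_t,ζ} = r`
  (flat local homomorphism, Matsumura Thm. 15.1 — IN TREE, `ringKrullDim_eq_add_of_flat` in
  `Resolution/SmoothUniformizationProofs`); (ii) `dim 𝒪_{𝒲,ζ} = dim 𝒪_{𝒳,ζ}/P` for SOME minimal prime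
  `P ⊇ 𝓘_ζ`, i.e. some component `𝒲_P ∋ ζ` of `𝒲`, and `codim_𝒳 ζ = dim 𝒪_{𝒳,ζ} ≥ ht P + dim 𝒪_{𝒳,ζ}/P`
  (chains concatenate; no catenarity needed); (iii) `ht P = codim_𝒳 (ξ_P) ≥ p` for every component of
  `𝒲` through a point over the connected component of `v₀` (a component of codimension `< p` is flat at
  its generic point, hence dominant, closed, so it meets `𝒳_{v₀}` in points of codimension `< p`,
  excluded by the binder `∀ z ∈ W₀ ∪ C, p ≤ codim z`; over other connected components of `V` take
  `T = ∅` there); so `codim_𝒳 ζ ≥ p + r`, whence (iv) `dim closure {ζ} = N - codim_𝒳 ζ ≤ e` and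
  `dim closure {z} ≤ e`, i.e. `codim_{𝒳_t} z = n - dim closure {z} ≥ p` (`height + coheight = dim` on the
  smooth irreducible `𝒳` and `𝒳_t` — IN TREE, `Motives.height_add_coheight_eq_of_smoothOfRelativeDimension`,
  `exists_height_eq_coheight_eq`; heights of `z` in `𝒳_t` and in `𝒳` agree, `𝒳_t ↪ 𝒳` being a closed
  immersion). Missing bookkeeping: stalk dimension `= Order.coheight` for scheme points, flatness of
  `𝒪_{V,t} → 𝒪_{𝒲,ζ}` from `Flat (ι ≫ g.left)`, the fibre ring `𝒪_{𝒲,ζ}/𝔪_t 𝒪_{𝒲,ζ}` versus the stalk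
  of `(fiberOver g t).left`, height under closed immersions, irreducibility of `𝒳` over an irreducible
  `V`. (Hartshorne III Prop. 9.5 packages (i)–(iv) as `dim_z 𝒲_t = dim_z 𝒲 - dim 𝒪_{V,t}`.)
  [cite: Matsumura1987, Thm. 15.1] [cite: Hartshorne1977, III Prop. 9.5 and Cor. 9.6]
* (F5) PURITY AND NON-VANISHING ON THE COMPACT FIBRE [M given (F1) on the fibre]: `classesSupportedOn X₀ W₀
  (2p) = ℂ · cl(W₀)` with `cl(W₀) ≠ 0` (Fulton Lemma 19.1.1). Tree: the LINE half is PROVED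
  (`exists_ker_restrictCompl_le_span_of_isIrreducible`, `finrank_ker_restrictCompl_le_one_of_isIrreducible`,
  file `SupportedClassesPurity`); the non-vanishing of the class of an irreducible closed subvariety of a
  smooth projective variety is ABSENT (for smooth `W₀` it would be `complexGysin … 1 ≠ 0`, not in tree
  either). The glue `HeckePrymWeilLine.semiregularSpread_of_blochLifts_of_fulton` uses `w ≠ 0` only to
  compare with the non-zero seed class, so (F5) is needed exactly as stated. [cite: Fulton1998, §19.1 Lemma 19.1.1]

Load-bearing and specific: (F1)+(F2) (a cycle class map for families on real carriers) [L–XL]; generic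
commutative algebra: (F4) [M]; (F3) done here [S]; (F5) half done (line proved, non-vanishing absent) [M].

References: [Fulton1998] §1.5, §10.1 Prop. 10.1 (a), Cor. 10.1; §19.1 eq. (1), Lemma 19.1.1; §19.2
Cor. 19.2 (b), Ex. 19.2.1. [GrothendieckTopology1969] §1. [Matsumura1987] Thm. 15.1, 15.6.
[Hartshorne1977] III Prop. 9.5, Cor. 9.6. [VoisinHodgeII2003] §9.2 (Prop. 9.21).
-/

-- every declaration of this problem lives in `Summit.HodgeConjecture.HodgeConjecture.…` (summit = sub-problem)
set_option linter.dupNamespace false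

noncomputable section

open CategoryTheory CategoryTheory.Limits AlgebraicGeometry
open Literature.AlgebraicGeometry.Motives Literature.AlgebraicGeometry.HodgeTheory
open Literature.AlgebraicTopology.SingularHomology

namespace Summit.HodgeConjecture.HodgeConjecture.Theorems

variable {𝒳 V : SchemeOver ℂ}

/-- **The support step (Fulton §19.1 eq. (1) on the tree's carriers).** If a global class
`Γ ∈ H²ᵖ(𝒳(ℂ); ℂ)` is supported on a Zariski-closed `T ⊆ 𝒳` and every point of the slice `𝒳_t ∩ T` has
codimension `≥ p` in the fibre `𝒳_t`, then the fibre restriction `Γ|_{𝒳_t}` is an algebraic class of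
codimension `p` on `𝒳_t`: it is supported on the Zariski-closed preimage of `T` under `𝒳_t ⟶ 𝒳`
(pull-back respects supports), which has codimension `≥ p`, and such classes lie in
`Nᵖ H²ᵖ = algebraicClasses` by definition. [cite: Fulton1998, §19.1 eq. (1)]
[cite: GrothendieckTopology1969, §1] -/
theorem map_fiberι_mem_algebraicClasses_of_mem_classesSupportedOn (g : 𝒳 ⟶ V) {p : ℕ}
    {T : Set 𝒳.left} (hT : IsClosed T) {Γ : complexBetti 𝒳 (2 * p)}
    (hΓ : Γ ∈ classesSupportedOn 𝒳 T (2 * p)) (t : ComplexPoints V)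
    (hcodim : ∀ z : (fiberOver g t).left, (fiberι g t).left.base z ∈ T → (p : ℕ∞) ≤ Order.coheight z) :
    complexBetti.map (fiberι g t) (2 * p) Γ ∈ algebraicClasses (fiberOver g t) p :=
  classesSupportedOn_le_supportedClasses (hT.preimage (fiberι g t).left.continuous)
    (fun z hz => hcodim z hz) _ (mem_classesSupportedOn_map_preimage (fiberι g t) hΓ)

/-- **All fibre restrictions at once**: under the hypotheses of the support step at every complex point
`t` of the base, conclusion (1) of `fulton1998_flatFamily_cycleClass_specialises` holds for `Γ`.
[cite: Fulton1998, §19.1 eq. (1)] -/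
theorem forall_map_fiberι_mem_algebraicClasses_of_mem_classesSupportedOn (g : 𝒳 ⟶ V) {p : ℕ}
    {T : Set 𝒳.left} (hT : IsClosed T) {Γ : complexBetti 𝒳 (2 * p)}
    (hΓ : Γ ∈ classesSupportedOn 𝒳 T (2 * p))
    (hcodim : ∀ (t : ComplexPoints V) (z : (fiberOver g t).left),
      (fiberι g t).left.base z ∈ T → (p : ℕ∞) ≤ Order.coheight z) :
    ∀ t : ComplexPoints V,
      complexBetti.map (fiberι g t) (2 * p) Γ ∈ algebraicClasses (fiberOver g t) p :=
  fun t => map_fiberι_mem_algebraicClasses_of_mem_classesSupportedOn g hT hΓ t (hcodim t)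

/-- **Reduction of Fulton's fact to a supported relative class `(RC)`.** The named fact
`fulton1998_flatFamily_cycleClass_specialises` follows from: in the interior range `0 < p ≤ n`, for the
data of the fact there are a Zariski-closed `T ⊆ 𝒳` all of whose fibre slices have codimension `≥ p` in
their fibre ((F4) of the module docstring, for `T` the codimension-`p` part of the flat family), a global
class `Γ` supported on `T` ((F1)), and `w ≠ 0`, `c₀ ≠ 0` with `w` supported on `W₀` and
`Γ|_{X₀} - c₀ • w` supported on `C` ((F2), (F5)). Conclusion (1) is the support step; the corners
`p = 0`, `p > n` are `fulton1998_flatFamily_cycleClass_specialises_of_interior`.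
[cite: Fulton1998, §10.1 Prop. 10.1 (a) and Cor. 10.1; §19.1 eq. (1) and Lemma 19.1.1; §19.2 Cor. 19.2 (b)] -/
theorem fulton1998_flatFamily_cycleClass_specialises_of_supportedRelativeClass
    (h : ∀ ⦃n p : ℕ⦄ ⦃𝒳 V : SchemeOver ℂ⦄ (g : 𝒳 ⟶ V), 0 < p → p ≤ n → IsSmoothProjectiveFamily g n →
      AlgebraicGeometry.Smooth V.hom →
      ∀ (𝒲 : Scheme) (ι : 𝒲 ⟶ 𝒳.left), IsClosedImmersion ι → Flat (ι ≫ g.left) →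
      ∀ (v₀ : ComplexPoints V) (W₀ C : Set (fiberOver g v₀).left),
      IsClosed W₀ → IsIrreducible W₀ → IsClosed C →
      Set.range (pullback.snd ι (fiberι g v₀).left).base = W₀ ∪ C → ¬ (W₀ ⊆ C) →
      (∀ z ∈ W₀ ∪ C, (p : ℕ∞) ≤ Order.coheight z) → (∃ z ∈ W₀, Order.coheight z = p) →
      ∃ (T : Set 𝒳.left) (Γ : complexBetti 𝒳 (2 * p)) (w : complexBetti (fiberOver g v₀) (2 * p))
        (c₀ : ℂ), IsClosed T ∧
        (∀ (t : ComplexPoints V) (z : (fiberOver g t).left),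
          (fiberι g t).left.base z ∈ T → (p : ℕ∞) ≤ Order.coheight z) ∧
        Γ ∈ classesSupportedOn 𝒳 T (2 * p) ∧
        w ∈ classesSupportedOn (fiberOver g v₀) W₀ (2 * p) ∧ w ≠ 0 ∧ c₀ ≠ 0 ∧
        complexBetti.map (fiberι g v₀) (2 * p) Γ - c₀ • w ∈
          classesSupportedOn (fiberOver g v₀) C (2 * p)) :
    fulton1998_flatFamily_cycleClass_specialises := by
  refine fulton1998_flatFamily_cycleClass_specialises_of_interior ?_
  intro n p 𝒳 V g hp hpn hg hV 𝒲 ι hι hflat v₀ W₀ C hW₀ hirr hC hrange hWC hcodim hz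
  obtain ⟨T, Γ, w, c₀, hT, hTcodim, hΓ, hw, hw0, hc₀, hdiff⟩ :=
    h g hp hpn hg hV 𝒲 ι hι hflat v₀ W₀ C hW₀ hirr hC hrange hWC hcodim hz
  exact ⟨Γ, w, c₀,
    forall_map_fiberι_mem_algebraicClasses_of_mem_classesSupportedOn g hT hΓ hTcodim, hw, hw0, hc₀, hdiff⟩

end Summit.HodgeConjecture.HodgeConjecture.Theorems

end
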